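import Literature.MathematicalPhysics.QuantumFieldTheory.Balaban1983to89.Node00.TwoRunSitePeierlsCover

/-!
# NODE 00 — THE PEIERLS COVER AS A FINITE INDEXED FAMILY: `animalCoverFamily τ n` = the pairs `(z, S)` with `S ∋ z` a connected `n`-set, its cardinality bound
# `≤ |α| · Δ^{2(n−1)}`, and the cover «big component of `Z` ⇒ some member of the family lies inside `Z`» — the shape a weighted union bound consumes

Cell `pub-ymgap`, YM-PLAN Track A (HUMAN RULING D-0062; width push D-0149); seat `pub-ymgap-dag-n20-d` (R134 (a) N20 NE7b s3) gen 32 — companion of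
`Node00/TwoRunSitePeierlsCover` (`touchingGraph`, `exists_connected_finset_of_hasBigComponent`, `ncard_touchAnimals_le_pow`, `degree_touchingGraph_siteTouch_le`).
[LF-II] = [Balaban1989LargeFieldII].

WHY.  A weighted union bound (the per-level letter `a K j` of `Summits/…/BalabanUVNodesSpineReadingOfRecord13CoPHKComponentSizeLevels` from an energy letter per connected
set) sums over a FINITE INDEX SET of events with a CARDINALITY bound; `Node00/TwoRunSitePeierlsCover` states the cover with `Set.ncard`.  This file packages the same cover
as `Finset`s: `animalsThrough τ z n` (the connected `n`-sets through `z`), `animalCoverFamily τ n` (all pairs `(z, S)`), their membership lemmas, ★ `card_animalCoverFamily_le`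
(`≤ Fintype.card α · Δ^{2(n−1)}` when degrees `≤ Δ`), ★★ `exists_mem_animalCoverFamily_subset_of_hasBigComponent` (the cover), and the torus instances — with the SHARP
degree bound `degree_touchingGraph_siteTouch_le_pred` (`≤ 3^d − 1`: the translate by `δ = 0` is the site itself; ref-F READ-798 NIT-sharpness-1 answered here) beside `3^d`.
HONEST — WHAT THIS IS NOT.  Pure combinatorics (two `def`s = classical `Finset.filter`s, theorems); NO weight, NO measure, NO estimate; the energy letter is NOT typed; nothing of
Bałaban's asserted; NE7 ∕ NE7b ∕ NE7c NOT PRINTED for `d = 4` and NOT proved; no node count moves (typed 28∕28 · discharged 8∕27); no `sorry`, no `axiom`, no `instance`, no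
`notation`; one finite four-torus programme at fixed `ε` — NOT ℝ⁴, NOT OS, NOT a mass gap, NOT the Clay problem.
-/

noncomputable section

open scoped BigOperators

namespace Literature.MathematicalPhysics.QuantumFieldTheory.Balaban1983to89.Node00

open T4Continuum B14.Eq213MaximalDomains B15Eq112TorusCover B14DomainGeom B14.Eq218Concrete

/-! ## §1  The animals through a point and the cover family, as finsets -/

section Family

variable {α : Type*} [Fintype α] [DecidableEq α] (τ : α → α → Prop)

open scoped Classical in
/-- **THE CONNECTED `n`-SETS THROUGH `z`** («animals»), as a finset (classical filter of all finsets). [cite: Balaban1989LargeFieldII, (1.80) p.384 (bookkeeping)] -/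
def animalsThrough (z : α) (n : ℕ) : Finset (Finset α) :=
  (Finset.univ : Finset (Finset α)).filter fun S => z ∈ S ∧ S.card = n ∧ ((touchingGraph τ).induce (S : Set α)).Connected

/-- Membership. [cite: Balaban1989LargeFieldII, (1.80) p.384 (bookkeeping)] -/
theorem mem_animalsThrough_iff (z : α) (n : ℕ) (S : Finset α) :
    S ∈ animalsThrough τ z n ↔ z ∈ S ∧ S.card = n ∧ ((touchingGraph τ).induce (S : Set α)).Connected := by
  classical
  unfold animalsThrough
  rw [Finset.mem_filter]
  exact ⟨fun h => h.2, fun h => ⟨Finset.mem_univ _, h⟩⟩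

/-- As a set it is the set counted in `Node00/TwoRunSitePeierlsCover`. [cite: Balaban1989LargeFieldII, (1.80) p.384 (bookkeeping)] -/
theorem coe_animalsThrough (z : α) (n : ℕ) :
    (↑(animalsThrough τ z n) : Set (Finset α)) = {S : Finset α | z ∈ S ∧ S.card = n ∧ ((touchingGraph τ).induce (S : Set α)).Connected} := by
  ext S
  rw [Finset.mem_coe, mem_animalsThrough_iff, Set.mem_setOf_eq]

/-- ★ **AT MOST `Δ^{2(n−1)}` ANIMALS THROUGH A POINT** (degrees `≤ Δ`; `ncard_touchAnimals_le_pow` BY NAME). [cite: Balaban1989LargeFieldII, (1.80) p.384 (bookkeeping)] -/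
theorem card_animalsThrough_le [DecidableRel (touchingGraph τ).Adj] {Δ : ℕ} (hΔ : ∀ a, (touchingGraph τ).degree a ≤ Δ) (z : α) (n : ℕ) :
    (animalsThrough τ z n).card ≤ Δ ^ (2 * (n - 1)) := by
  rw [← Set.ncard_coe_finset, coe_animalsThrough]
  exact ncard_touchAnimals_le_pow τ hΔ z n

/-- **THE COVER FAMILY**: all pairs `(z, S)` with `S` a connected `n`-set through `z`.  (Named `animalCoverFamily` to stay clear of
`Literature.Combinatorics.SimpleGraph.coverFamily` of `HamiltonianGadgetForcing` and its readers.) [cite: Balaban1989LargeFieldII, (1.80) p.384 (bookkeeping)] -/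
def animalCoverFamily (n : ℕ) : Finset (α × Finset α) :=
  (Finset.univ : Finset α).biUnion fun z => (animalsThrough τ z n).map (Function.Embedding.sectR z (Finset α))

/-- Membership: `(z, S) ∈ animalCoverFamily τ n ↔ S ∈ animalsThrough τ z n`. [cite: Balaban1989LargeFieldII, (1.80) p.384 (bookkeeping)] -/
theorem mem_animalCoverFamily_iff (n : ℕ) (p : α × Finset α) : p ∈ animalCoverFamily τ n ↔ p.2 ∈ animalsThrough τ p.1 n := by
  unfold animalCoverFamily
  rw [Finset.mem_biUnion]
  constructor
  · rintro ⟨z, -, hz⟩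
    rw [Finset.mem_map] at hz
    obtain ⟨S, hS, rfl⟩ := hz
    exact hS
  · intro hp
    refine ⟨p.1, Finset.mem_univ _, ?_⟩
    rw [Finset.mem_map]
    exact ⟨p.2, hp, rfl⟩

/-- Members are connected `n`-sets through their base point. [cite: Balaban1989LargeFieldII, (1.80) p.384 (bookkeeping)] -/
theorem mem_animalCoverFamily_iff' (n : ℕ) (p : α × Finset α) :
    p ∈ animalCoverFamily τ n ↔ p.1 ∈ p.2 ∧ p.2.card = n ∧ ((touchingGraph τ).induce (p.2 : Set α)).Connected := by
  rw [mem_animalCoverFamily_iff, mem_animalsThrough_iff]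

/-- ★ **THE COVER FAMILY HAS AT MOST `|α| · Δ^{2(n−1)}` MEMBERS** (degrees `≤ Δ`). [cite: Balaban1989LargeFieldII, (1.80) p.384 (bookkeeping)] -/
theorem card_animalCoverFamily_le [DecidableRel (touchingGraph τ).Adj] {Δ : ℕ} (hΔ : ∀ a, (touchingGraph τ).degree a ≤ Δ) (n : ℕ) :
    (animalCoverFamily τ n).card ≤ Fintype.card α * Δ ^ (2 * (n - 1)) := by
  unfold animalCoverFamily
  calc ((Finset.univ : Finset α).biUnion fun z => (animalsThrough τ z n).map (Function.Embedding.sectR z (Finset α))).card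
      ≤ ∑ z : α, ((animalsThrough τ z n).map (Function.Embedding.sectR z (Finset α))).card := Finset.card_biUnion_le
    _ = ∑ z : α, (animalsThrough τ z n).card := by simp only [Finset.card_map]
    _ ≤ ∑ _z : α, Δ ^ (2 * (n - 1)) := Finset.sum_le_sum fun z _ => card_animalsThrough_le τ hΔ z n
    _ = Fintype.card α * Δ ^ (2 * (n - 1)) := by rw [Finset.sum_const, smul_eq_mul, Finset.card_univ]

/-- ★★ **THE COVER**: a set `Z` with a component of at least `m j ≥ 1` points contains the connected set of some member of `animalCoverFamily τ (m j)`.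
[cite: Balaban1989LargeFieldII, (1.80) p.384 (bookkeeping)] -/
theorem exists_mem_animalCoverFamily_subset_of_hasBigComponent {m : ℕ → ℕ} {j : ℕ} (h1 : 1 ≤ m j) {Z : Set α} (h : HasBigComponent τ (bigOfCard m j) Z) :
    ∃ p ∈ animalCoverFamily τ (m j), (p.2 : Set α) ⊆ Z := by
  obtain ⟨z, -, S, hSZ, hzS, hS, hSc⟩ := exists_connected_finset_of_hasBigComponent τ h1 h
  exact ⟨(z, S), (mem_animalCoverFamily_iff' τ (m j) (z, S)).2 ⟨hzS, hS, hSc⟩, hSZ⟩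

/-- The cover as an inclusion of events over a FINITE index set. [cite: Balaban1989LargeFieldII, (1.80) p.384 (bookkeeping)] -/
theorem setOf_hasBigComponent_subset_biUnion_animalCoverFamily {m : ℕ → ℕ} {j : ℕ} (h1 : 1 ≤ m j) :
    {Z : Set α | HasBigComponent τ (bigOfCard m j) Z} ⊆ ⋃ p ∈ animalCoverFamily τ (m j), {Z : Set α | (p.2 : Set α) ⊆ Z} := by
  intro Z hZ
  obtain ⟨p, hp, hpZ⟩ := exists_mem_animalCoverFamily_subset_of_hasBigComponent τ h1 hZ
  simp only [Set.mem_iUnion, Set.mem_setOf_eq, exists_prop]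
  exact ⟨p, hp, hpZ⟩

end Family

/-! ## §2  The torus instances -/

section Torus

variable {P : Params} {j : ℕ}

/-- **THE SHARP TORUS DEGREE BOUND `3^d − 1`** (ref-F READ-798 NIT-sharpness-1 on `degree_touchingGraph_siteTouch_le`: the translate by `δ = 0` is `z` itself, never a
neighbour of a loopless graph). [cite: Balaban1989LargeFieldII, (1.84) p.386 (bookkeeping)] -/
theorem degree_touchingGraph_siteTouch_le_pred [DecidableRel (touchingGraph (SiteTouch (P := P) (j := j))).Adj] (z : Site P j) :
    (touchingGraph (SiteTouch (P := P) (j := j))).degree z ≤ 3 ^ P.d - 1 := by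
  classical
  set D : Finset (Site P j) :=
    (Fintype.piFinset fun _ : Fin P.d => ({0, 1, -1} : Finset (ZMod (P.sitesPerDir j)))).image fun δ => z + δ with hD
  have hsub : (touchingGraph (SiteTouch (P := P) (j := j))).neighborFinset z ⊆ D.erase z := by
    intro z' hz'
    rw [_root_.SimpleGraph.mem_neighborFinset, touchingGraph_adj] at hz'
    refine Finset.mem_erase.2 ⟨fun h => hz'.1 h.symm, ?_⟩
    rw [hD, Finset.mem_image]
    refine ⟨z' - z, Fintype.mem_piFinset.2 fun μ => ?_, add_sub_cancel z z'⟩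
    rcases hz'.2 with h | h
    · exact siteTouch_sub_mem z z' h μ
    · exact siteTouch_sub_mem' z z' h μ
  have hzD : z ∈ D := by
    rw [hD, Finset.mem_image]
    exact ⟨0, Fintype.mem_piFinset.2 fun μ => Finset.mem_insert.2 (Or.inl rfl), add_zero z⟩
  have hDcard : D.card ≤ 3 ^ P.d :=
    calc D.card ≤ (Fintype.piFinset fun _ : Fin P.d => ({0, 1, -1} : Finset (ZMod (P.sitesPerDir j)))).card := Finset.card_image_le
      _ = ∏ _μ : Fin P.d, ({0, 1, -1} : Finset (ZMod (P.sitesPerDir j))).card := Fintype.card_piFinset _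
      _ ≤ 3 ^ (Finset.univ : Finset (Fin P.d)).card := Finset.prod_le_pow_card _ _ 3 fun _ _ => Finset.card_le_three
      _ = 3 ^ P.d := by rw [Finset.card_univ, Fintype.card_fin]
  calc (touchingGraph (SiteTouch (P := P) (j := j))).degree z
      = ((touchingGraph (SiteTouch (P := P) (j := j))).neighborFinset z).card := (_root_.SimpleGraph.card_neighborFinset_eq_degree _ z).symm
    _ ≤ (D.erase z).card := Finset.card_le_card hsub
    _ = D.card - 1 := Finset.card_erase_of_mem hzD
    _ ≤ 3 ^ P.d - 1 := Nat.sub_le_sub_right hDcard 1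

/-- ★ On the torus with site-level touching the cover family of size-`n` animals has at most `|sites| · (3^d − 1)^{2(n−1)}` members. [cite: Balaban1989LargeFieldII, (1.80) p.384 (bookkeeping)] -/
theorem card_animalCoverFamily_siteTouch_le_pred [DecidableRel (touchingGraph (SiteTouch (P := P) (j := j))).Adj] (n : ℕ) :
    (animalCoverFamily (SiteTouch (P := P) (j := j)) n).card ≤ Fintype.card (Site P j) * (3 ^ P.d - 1) ^ (2 * (n - 1)) :=
  card_animalCoverFamily_le SiteTouch degree_touchingGraph_siteTouch_le_pred n

/-- … and the rounder `|sites| · (3^d)^{2(n−1)}`. [cite: Balaban1989LargeFieldII, (1.80) p.384 (bookkeeping)] -/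
theorem card_animalCoverFamily_siteTouch_le [DecidableRel (touchingGraph (SiteTouch (P := P) (j := j))).Adj] (n : ℕ) :
    (animalCoverFamily (SiteTouch (P := P) (j := j)) n).card ≤ Fintype.card (Site P j) * (3 ^ P.d) ^ (2 * (n - 1)) :=
  card_animalCoverFamily_le SiteTouch degree_touchingGraph_siteTouch_le n

/-- ★★ On the torus: a large-field region with a component of `≥ m lvl ≥ 1` sites contains the connected site set of some member of `animalCoverFamily SiteTouch (m lvl)`.
[cite: Balaban1989LargeFieldII, (1.80) p.384 (bookkeeping)] -/
theorem exists_mem_animalCoverFamily_siteTouch_of_hasBigComponent {m : ℕ → ℕ} {lvl : ℕ} (h1 : 1 ≤ m lvl) {Z : Set (Site P j)}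
    (h : HasBigComponent SiteTouch (bigOfCard m lvl) Z) :
    ∃ p ∈ animalCoverFamily (SiteTouch (P := P) (j := j)) (m lvl), (p.2 : Set (Site P j)) ⊆ Z := by
  classical
  exact exists_mem_animalCoverFamily_subset_of_hasBigComponent SiteTouch h1 h

end Torus

end Literature.MathematicalPhysics.QuantumFieldTheory.Balaban1983to89.Node00

end
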